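import Mathlib
import Summits.Ventures.HodgeRepro2.Tier7.Line3.KappaArchimedean

/-!
# Tier 7 — LINE 3 support: the two-torus invariant under a swap of either adapted basis (`κ ↦ 1 − κ`)
(`Line3/KappaSwap.lean`; t7-L1-p5, gen 2; closes t7-crit-2's record (3) on `KappaNatural`, STATUS l. 15198)

`KappaNatural.kappa_eq_normSq` / `KappaArchimedean.Sig11Data` state the archimedean dictionary for the ORDERED adapted
bases with the positive line first (`r 0 > 0`, `s 0 > 0`). This file supplies the other orderings: swapping the second
basis (`kappa_swap_second`) or the first basis (`kappa_swap_first`, with the coordinate change `S = !![0,1;1,0]`)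
replaces `κ` by `1 − κ` — p1's Gram relations `nrm_cc_zero_one` / `nrm_cc_one_zero` (`N(c₀₁) = (1−κ) d₀ d′₁`,
`N(c₁₀) = (1−κ) d₁ d′₀`). Hence at a `(1,1)`-place with the NEGATIVE line first (`r 0 < 0 < r 1`) the invariant of the
adapted coordinates is `1 − |(P (S γ S) Q · H)₀₀|² ≤ 0` for the swapped datum (`kappa_eq_one_sub_normSq_of_neg_first`,
`kappa_nonpos_of_neg_first`), and with the second basis negative-first (`s 0 < 0 < s 1`) it is `1 − κ_{r, swap f}`
(`kappa_eq_one_sub_of_second_neg_first`). So the ordering convention is immaterial: the dictionary applies to every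
ordering of the adapted bases, with `κ` or `1 − κ` as the Cartan size.
Nothing about the real group, periods or (N). Pure algebra.
Sorry-free; axioms: propext / Classical.choice / Quot.sound. §8(d): uses an L-value-free non-vanishing device: NO.
-/

namespace Summit.Ventures.HodgeRepro2.Tier7.Line3.KappaSwap

open Matrix Summit.Ventures.HodgeRepro2.T7SupportTwoTorusInvariant
  Summit.Ventures.HodgeRepro2.Tier7.Line3.KappaNatural Summit.Ventures.HodgeRepro2.Tier7.Line3.KappaArchimedean

section general

variable {E : Type*} [Field E] (σ : E →+* E)

/-- the swap matrix `S = !![0, 1; 1, 0]` (`S⁻¹ = S`) -/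
def S (E : Type*) [Field E] : Matrix (Fin 2) (Fin 2) E := !![0, 1; 1, 0]

/-- `S x = (x₁, x₀)` -/
theorem S_mulVec (x : Fin 2 → E) : S E *ᵥ x = ![x 1, x 0] := by
  funext i
  fin_cases i <;> simp [S, mulVec_two]

/-- `S S = 1` -/
theorem S_mul_S : S E * S E = 1 := by
  ext i j
  fin_cases i <;> fin_cases j <;> simp [S, Matrix.mul_apply, Fin.sum_univ_two]

/-- `S` carries `herm σ d` to `herm σ (d₁, d₀)` -/
theorem herm_S_mulVec (d : Fin 2 → E) (x y : Fin 2 → E) :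
    herm σ ![d 1, d 0] (S E *ᵥ x) (S E *ᵥ y) = herm σ d x y := by
  rw [S_mulVec, S_mulVec, herm_eq, herm_eq]
  simp only [Matrix.cons_val_zero, Matrix.cons_val_one]
  ring

/-- **swapping the second basis**: `κ_{d, (f₁, f₀)}(γ) = 1 − κ_{d, f}(γ)` -/
theorem kappa_swap_second (hσ : ∀ x, σ (σ x) = x) (d : Fin 2 → E) (hd : ∀ i, σ (d i) = d i)
    (hd0 : ∀ i, d i ≠ 0) (f : Fin 2 → Fin 2 → E) (horth : herm σ d (f 0) (f 1) = 0)
    (hf0 : disc' σ d f 0 ≠ 0) (hf1 : disc' σ d f 1 ≠ 0) (γ : Matrix (Fin 2) (Fin 2) E)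
    (hγ : IsIsom σ d γ) :
    kappa σ d ![f 1, f 0] γ = 1 - kappa σ d f γ := by
  have h1 : cc d ![f 1, f 0] γ 0 0 = cc d f γ 0 1 := by simp [cc]
  have h2 : disc' σ d ![f 1, f 0] 0 = disc' σ d f 1 := by simp [disc']
  conv_lhs => unfold kappa
  rw [h1, h2, nrm_cc_zero_one σ hσ d hd hd0 f horth hf0 γ hγ]
  have hne : d 0 * disc' σ d f 1 ≠ 0 := mul_ne_zero (hd0 0) hf1
  rw [mul_assoc ((1 : E) - kappa σ d f γ), mul_div_cancel_right₀ _ hne]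

/-- **swapping the first basis** (coordinates `x ↦ S x`, discriminants `(d₁, d₀)`, second basis `S f_j`, matrix
`S γ S`): `κ = 1 − κ_{d, f}(γ)` -/
theorem kappa_swap_first (d : Fin 2 → E) (hd : ∀ i, σ (d i) = d i) (hd0 : ∀ i, d i ≠ 0)
    (f : Fin 2 → Fin 2 → E) (hf0 : disc' σ d f 0 ≠ 0) (γ : Matrix (Fin 2) (Fin 2) E) (hγ : IsIsom σ d γ) :
    kappa σ ![d 1, d 0] (fun j => S E *ᵥ f j) (S E * γ * S E) = 1 - kappa σ d f γ := by
  have hv : (S E * γ * S E) *ᵥ (S E *ᵥ f 0) = S E *ᵥ (γ *ᵥ f 0) := by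
    rw [mulVec_mulVec, Matrix.mul_assoc, S_mul_S, Matrix.mul_one, ← mulVec_mulVec]
  have h1 : cc ![d 1, d 0] (fun j => S E *ᵥ f j) (S E * γ * S E) 0 0 = cc d f γ 1 0 := by
    show (![d 1, d 0] : Fin 2 → E) 0 * ((S E * γ * S E) *ᵥ (S E *ᵥ f 0)) 0 = d 1 * (γ *ᵥ f 0) 1
    rw [hv, S_mulVec]
    simp
  have h2 : disc' σ ![d 1, d 0] (fun j => S E *ᵥ f j) 0 = disc' σ d f 0 := by
    unfold disc'
    exact herm_S_mulVec σ d (f 0) (f 0)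
  conv_lhs => unfold kappa
  rw [h1, h2, nrm_cc_one_zero σ d hd hd0 f hf0 γ hγ]
  have hne : d 1 * disc' σ d f 0 ≠ 0 := mul_ne_zero (hd0 1) hf0
  simp only [Matrix.cons_val_zero]
  rw [mul_assoc ((1 : E) - kappa σ d f γ), mul_div_cancel_right₀ _ hne]

/-- `S γ S` is an isometry of `herm σ (d₁, d₀)` when `γ` is one of `herm σ d` -/
theorem isIsom_S_conj (d : Fin 2 → E) {γ : Matrix (Fin 2) (Fin 2) E} (hγ : IsIsom σ d γ) :
    IsIsom σ ![d 1, d 0] (S E * γ * S E) := by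
  intro x y
  have h : ∀ z : Fin 2 → E, (S E * γ * S E) *ᵥ z = S E *ᵥ (γ *ᵥ (S E *ᵥ z)) := by
    intro z
    rw [mulVec_mulVec, mulVec_mulVec]
  rw [h, h, herm_S_mulVec, hγ, ← herm_S_mulVec σ d, mulVec_mulVec, mulVec_mulVec, S_mul_S, one_mulVec,
    one_mulVec]

/-- the swapped second basis stays orthogonal, with the discriminants exchanged -/
theorem disc'_S_mulVec (d : Fin 2 → E) (f : Fin 2 → Fin 2 → E) (j : Fin 2) :
    disc' σ ![d 1, d 0] (fun j => S E *ᵥ f j) j = disc' σ d f j := by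
  unfold disc'
  exact herm_S_mulVec σ d (f j) (f j)

end general

/-! ## Over `ℂ`: the other orderings at a `(1,1)`-place -/

section complex

open Complex

/-- the real discriminants of the swapped first basis -/
theorem swap_real (r : Fin 2 → ℝ) :
    (![((r 1 : ℝ) : ℂ), ((r 0 : ℝ) : ℂ)] : Fin 2 → ℂ) = fun i => ((![r 1, r 0] : Fin 2 → ℝ) i : ℂ) := by
  funext i
  fin_cases i <;> simp

/-- the swapped data with the NEGATIVE line first is a `Sig11Data` after the swap -/
theorem sig11Data_swap {r s : Fin 2 → ℝ} (hr0 : r 0 < 0) (hr1 : 0 < r 1) (hs0 : 0 < s 0) (hs1 : s 1 < 0)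
    (f : Fin 2 → Fin 2 → ℂ) (hf0 : disc' (starRingEnd ℂ) (fun i => (r i : ℂ)) f 0 = (s 0 : ℂ))
    (hf1 : disc' (starRingEnd ℂ) (fun i => (r i : ℂ)) f 1 = (s 1 : ℂ))
    (horth : herm (starRingEnd ℂ) (fun i => (r i : ℂ)) (f 0) (f 1) = 0) :
    Sig11Data ![r 1, r 0] s (fun j => S ℂ *ᵥ f j) where
  hr0 := by simpa using hr1
  hr1 := by simpa using hr0
  hs0 := hs0
  hs1 := hs1
  hf0 := by
    have := disc'_S_mulVec (starRingEnd ℂ) (fun i => (r i : ℂ)) f 0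
    rw [swap_real] at this
    rw [this, hf0]
  hf1 := by
    have := disc'_S_mulVec (starRingEnd ℂ) (fun i => (r i : ℂ)) f 1
    rw [swap_real] at this
    rw [this, hf1]
  horth := by
    have := herm_S_mulVec (starRingEnd ℂ) (fun i => (r i : ℂ)) (f 0) (f 1)
    rw [swap_real] at this
    rw [this, horth]

/-- **the `(1,1)`-dictionary with the negative line first**: `κ_{r,f}(γ) = 1 − |(P (S γ S) Q · H)₀₀|²` for the
swapped datum -/
theorem kappa_eq_one_sub_normSq_of_neg_first {r s : Fin 2 → ℝ} (hr0 : r 0 < 0) (hr1 : 0 < r 1)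
    (hs0 : 0 < s 0) (f : Fin 2 → Fin 2 → ℂ)
    (hf0 : disc' (starRingEnd ℂ) (fun i => (r i : ℂ)) f 0 = (s 0 : ℂ))
    {γ : Matrix (Fin 2) (Fin 2) ℂ} (hγ : IsIsom (starRingEnd ℂ) (fun i => (r i : ℂ)) γ) :
    kappa (starRingEnd ℂ) (fun i => (r i : ℂ)) f γ =
      1 - (Complex.normSq ((P ![r 1, r 0] * (S ℂ * γ * S ℂ) * Q ![r 1, r 0] *
        colMatrix (nf ![r 1, r 0] s (fun j => S ℂ *ᵥ f j))) 0 0) : ℂ) := by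
  have hd : ∀ i, (starRingEnd ℂ) ((fun i => (r i : ℂ)) i) = (fun i => (r i : ℂ)) i := fun i => by simp
  have hd0 : ∀ i, (fun i => (r i : ℂ)) i ≠ 0 := by
    intro i
    fin_cases i
    · simpa using hr0.ne
    · simpa using hr1.ne'
  have hf0' : disc' (starRingEnd ℂ) (fun i => (r i : ℂ)) f 0 ≠ 0 := by
    rw [hf0]; exact_mod_cast hs0.ne'
  have hsw := kappa_swap_first (starRingEnd ℂ) (fun i => (r i : ℂ)) hd hd0 f hf0' γ hγ
  rw [swap_real] at hsw
  have hdisc : disc' (starRingEnd ℂ) (fun i => ((![r 1, r 0] : Fin 2 → ℝ) i : ℂ))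
      (fun j => S ℂ *ᵥ f j) 0 = (s 0 : ℂ) := by
    have := disc'_S_mulVec (starRingEnd ℂ) (fun i => (r i : ℂ)) f 0
    rw [swap_real] at this
    rw [this, hf0]
  have hk := KappaNatural.kappa_eq_normSq (r := ![r 1, r 0]) (by simpa using hr1) (by simpa using hr0.ne)
    hs0 (fun j => S ℂ *ᵥ f j) hdisc (S ℂ * γ * S ℂ)
  rw [hk] at hsw
  linear_combination hsw

/-- with the negative line first, `κ ≤ 0` (real part) -/
theorem kappa_nonpos_of_neg_first {r s : Fin 2 → ℝ} (hr0 : r 0 < 0) (hr1 : 0 < r 1) (hs0 : 0 < s 0)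
    (hs1 : s 1 < 0) (f : Fin 2 → Fin 2 → ℂ)
    (hf0 : disc' (starRingEnd ℂ) (fun i => (r i : ℂ)) f 0 = (s 0 : ℂ))
    (hf1 : disc' (starRingEnd ℂ) (fun i => (r i : ℂ)) f 1 = (s 1 : ℂ))
    (horth : herm (starRingEnd ℂ) (fun i => (r i : ℂ)) (f 0) (f 1) = 0)
    {γ : Matrix (Fin 2) (Fin 2) ℂ} (hγ : IsIsom (starRingEnd ℂ) (fun i => (r i : ℂ)) γ) :
    (kappa (starRingEnd ℂ) (fun i => (r i : ℂ)) f γ).re ≤ 0 := by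
  have D := sig11Data_swap hr0 hr1 hs0 hs1 f hf0 hf1 horth
  have hiso := isIsom_S_conj (starRingEnd ℂ) (fun i => (r i : ℂ)) hγ
  rw [swap_real] at hiso
  have h1 := D.one_le_kappa hiso
  have hd : ∀ i, (starRingEnd ℂ) ((fun i => (r i : ℂ)) i) = (fun i => (r i : ℂ)) i := fun i => by simp
  have hd0 : ∀ i, (fun i => (r i : ℂ)) i ≠ 0 := by
    intro i
    fin_cases i
    · simpa using hr0.ne
    · simpa using hr1.ne'
  have hf0' : disc' (starRingEnd ℂ) (fun i => (r i : ℂ)) f 0 ≠ 0 := by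
    rw [hf0]; exact_mod_cast hs0.ne'
  have hsw := kappa_swap_first (starRingEnd ℂ) (fun i => (r i : ℂ)) hd hd0 f hf0' γ hγ
  rw [swap_real] at hsw
  have := congrArg Complex.re hsw
  simp only [Complex.sub_re, Complex.one_re] at this
  linarith

/-- **the second basis negative-first** (`s 0 < 0 < s 1`): `κ_{r,f}(γ) = 1 − κ_{r, (f₁, f₀)}(γ)`, and `(r, (f₁, f₀))`
is a `Sig11Data` when `r 0 > 0 > r 1` -/
theorem kappa_eq_one_sub_of_second_neg_first {r s : Fin 2 → ℝ} (hr0 : 0 < r 0) (hr1 : r 1 < 0)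
    (hs0 : s 0 < 0) (hs1 : 0 < s 1) (f : Fin 2 → Fin 2 → ℂ)
    (hf0 : disc' (starRingEnd ℂ) (fun i => (r i : ℂ)) f 0 = (s 0 : ℂ))
    (hf1 : disc' (starRingEnd ℂ) (fun i => (r i : ℂ)) f 1 = (s 1 : ℂ))
    (horth : herm (starRingEnd ℂ) (fun i => (r i : ℂ)) (f 0) (f 1) = 0)
    {γ : Matrix (Fin 2) (Fin 2) ℂ} (hγ : IsIsom (starRingEnd ℂ) (fun i => (r i : ℂ)) γ) :
    kappa (starRingEnd ℂ) (fun i => (r i : ℂ)) f γ =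
        1 - kappa (starRingEnd ℂ) (fun i => (r i : ℂ)) ![f 1, f 0] γ ∧
      Sig11Data r ![s 1, s 0] ![f 1, f 0] := by
  have hd : ∀ i, (starRingEnd ℂ) ((fun i => (r i : ℂ)) i) = (fun i => (r i : ℂ)) i := fun i => by simp
  have hd0 : ∀ i, (fun i => (r i : ℂ)) i ≠ 0 := by
    intro i
    fin_cases i
    · simpa using hr0.ne'
    · simpa using hr1.ne
  have hf0' : disc' (starRingEnd ℂ) (fun i => (r i : ℂ)) f 0 ≠ 0 := by
    rw [hf0]; exact_mod_cast hs0.ne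
  have hf1' : disc' (starRingEnd ℂ) (fun i => (r i : ℂ)) f 1 ≠ 0 := by
    rw [hf1]; exact_mod_cast hs1.ne'
  refine ⟨?_, ?_⟩
  · have := kappa_swap_second (starRingEnd ℂ) conj_conj' (fun i => (r i : ℂ)) hd hd0 f horth hf0' hf1' γ hγ
    linear_combination this
  · have h10 : herm (starRingEnd ℂ) (fun i => (r i : ℂ)) (f 1) (f 0) = 0 := by
      have := congrArg (starRingEnd ℂ) horth
      simp [herm_eq] at this ⊢
      linear_combination this
    exact
      { hr0 := hr0
        hr1 := hr1
        hs0 := by simpa using hs1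
        hs1 := by simpa using hs0
        hf0 := by simpa [disc'] using hf1
        hf1 := by simpa [disc'] using hf0
        horth := by simpa using h10 }

end complex

end Summit.Ventures.HodgeRepro2.Tier7.Line3.KappaSwap
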